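import Summits.BirchSwinnertonDyer.BirchSwinnertonDyer.Theorems.ManinLocalTwoThreeThreeShiftGlue
import HarnessLib

/-!
# The prime-generic descent engine, 0: relativised gluing lemmas
# (route `ManinLocalTwoThree`, cell bsd-f2-manin; cruxes C2 stmt-BirchSwinnertonDyer-22967 / C3 stmt-…-22968; LEAD seat p1 gen 12; the `K_{p,p}`
# steps of the LEAD's prime-generic shift-equaliser conjecture / typer's law `ShiftEqualiser.PrimeShiftInvariantIsDiamond`)

p3's abstract gluing lemma `ThreeShiftDescent.glue` (file `…ThreeShiftGlue.lean` §3) glues a compatible pair `(α on A, φ on B)` along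
`G = A·⟨t⟩` with `A ⊴ G`.  For a prime `p ≥ 5` the subgroup `A = {p ∣ b}` of `Γ₀(pm)` is NOT normal (the torus `(ℤ/p)ˣ` acts), so the
engine must run inside the index-`(p−1)/2` subgroup `G₁ = {a² ≡ 1 (mod p)}` and then be extended along the diagonal subgroup `D`.  This file
supplies the two abstract lemmas, for any group `G` and additive target `Z`:
* `glueOn` — p3's `glue` RELATIVISED to a subgroup `G₁ ≤ G`: `A ≤ G₁` normalised by `G₁`, `t ∈ B ∩ G₁`, `α` additive on `A` and `t`-invariant,
  `φ` additive on `B`, `α = φ` on `A ∩ B`, an exponent map `n` with `g t^{−n(g)} ∈ A` for `g ∈ G₁` ⟹ `W(g) := α(g t^{−n g}) + n(g)·φ(t)` is additive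
  ON `G₁`, restricts to `α` on `A` and to `φ` on `B ∩ G₁`;
* `glueExtend` — extension along a complement: `N ≤ G` normalised by `D ≤ G`, `G = D·N` pointwise, `w₁` additive on `N` and `D`-conjugation
  invariant, `α` additive on `D`, `α = w₁` on `D ∩ N` ⟹ `w(g) := α(d) + w₁(n)` (any decomposition `g = d n`) is well defined, additive on `G`,
  restricts to `w₁` on `N` and to `α` on `D`.
Nothing about BSD, Manin's conjecture or the equaliser laws is asserted here. [cite: DarmonDiamondTaylor1995, Lemma 4.28 (p. 135) (shape only)]
-/

set_option autoImplicit false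
set_option linter.dupNamespace false

namespace Summit.BirchSwinnertonDyer.BirchSwinnertonDyer.Theorems.ManinLocalTwoThree

namespace PShiftGlue

open ThreeShiftDescent (addOn_map_one addOn_map_inv addOn_map_zpow)

variable {G : Type*} [Group G] {Z : Type*} [AddCommGroup Z]

/-- Conjugates by powers of `t` stay in `A` when `t` and `t⁻¹` normalise `A`. [folklore] -/
theorem conj_zpow_mem {A : Subgroup G} {t : G} (ht : ∀ a ∈ A, t * a * t⁻¹ ∈ A) (ht' : ∀ a ∈ A, t⁻¹ * a * t ∈ A) (k : ℤ) :
    ∀ a ∈ A, t ^ k * a * (t ^ k)⁻¹ ∈ A := by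
  induction k using Int.induction_on with
  | zero => intro a ha; simpa using ha
  | succ n ih =>
      intro a ha
      have e : t ^ ((n : ℤ) + 1) * a * (t ^ ((n : ℤ) + 1))⁻¹ = t ^ (n : ℤ) * (t * a * t⁻¹) * (t ^ (n : ℤ))⁻¹ := by group
      rw [e]; exact ih _ (ht a ha)
  | pred n ih =>
      intro a ha
      have e : t ^ (-(n : ℤ) - 1) * a * (t ^ (-(n : ℤ) - 1))⁻¹ = t ^ (-(n : ℤ)) * (t⁻¹ * a * t) * (t ^ (-(n : ℤ)))⁻¹ := by group
      rw [e]; exact ih _ (ht' a ha)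

omit [AddCommGroup Z] in
/-- Conjugation invariance by `t` on `A` implies invariance by every power `t^k` (with `t^{±1}` normalising `A`). [folklore] -/
theorem conj_zpow_invariant {A : Subgroup G} {α : G → Z} {t : G} (ht : ∀ a ∈ A, t * a * t⁻¹ ∈ A) (ht' : ∀ a ∈ A, t⁻¹ * a * t ∈ A)
    (hinv : ∀ a ∈ A, α (t * a * t⁻¹) = α a) (k : ℤ) : ∀ a ∈ A, α (t ^ k * a * (t ^ k)⁻¹) = α a := by
  induction k using Int.induction_on with
  | zero => intro a _; simp
  | succ n ih =>
      intro a ha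
      have e : t ^ ((n : ℤ) + 1) * a * (t ^ ((n : ℤ) + 1))⁻¹ = t ^ (n : ℤ) * (t * a * t⁻¹) * (t ^ (n : ℤ))⁻¹ := by group
      rw [e, ih _ (ht a ha), hinv a ha]
  | pred n ih =>
      intro a ha
      have hinv' : α (t⁻¹ * a * t) = α a := by
        have := hinv (t⁻¹ * a * t) (ht' a ha)
        rw [← this]; congr 1; group
      have e : t ^ (-(n : ℤ) - 1) * a * (t ^ (-(n : ℤ) - 1))⁻¹ = t ^ (-(n : ℤ)) * (t⁻¹ * a * t) * (t ^ (-(n : ℤ)))⁻¹ := by group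
      rw [e, ih _ (ht' a ha), hinv']

/-- **Gluing a compatible pair inside a subgroup `G₁`** (p3's `glue`, relativised).  `A` normalised by `G₁`, `B ≤ G`, `t ∈ B ∩ G₁`,
`α` additive on `A` and `t`-invariant, `φ` additive on `B`, `α = φ` on `A ∩ B`, `n : G → ℤ` with `g t^{−n(g)} ∈ A` for `g ∈ G₁` and
`t^{n(a)} ∈ A` for `a ∈ A`.  Then `W(g) := α(g t^{−n g}) + n(g)·φ(t)` is additive on `G₁`, `= α` on `A`, `= φ` on `B ∩ G₁`. [folklore] -/
theorem glueOn {G₁ A B : Subgroup G} (hAn : ∀ g ∈ G₁, ∀ a ∈ A, g * a * g⁻¹ ∈ A) {α φ : G → Z}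
    (hα : ∀ x ∈ A, ∀ y ∈ A, α (x * y) = α x + α y) (hφ : ∀ x ∈ B, ∀ y ∈ B, φ (x * y) = φ x + φ y)
    (hC : ∀ x ∈ A, x ∈ B → α x = φ x) {t : G} (ht : t ∈ B) (htG : t ∈ G₁) (hinv : ∀ a ∈ A, α (t * a * t⁻¹) = α a)
    (n : G → ℤ) (hn : ∀ g ∈ G₁, g * t ^ (-(n g)) ∈ A) (hnA : ∀ a ∈ A, t ^ (n a) ∈ A) :
    (∀ g ∈ G₁, ∀ h ∈ G₁, (α (g * h * t ^ (-(n (g * h)))) + n (g * h) • φ t) =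
        (α (g * t ^ (-(n g))) + n g • φ t) + (α (h * t ^ (-(n h))) + n h • φ t)) ∧
      (∀ a ∈ A, α (a * t ^ (-(n a))) + n a • φ t = α a) ∧
      (∀ b ∈ B, b ∈ G₁ → α (b * t ^ (-(n b))) + n b • φ t = φ b) := by
  have htA : ∀ a ∈ A, t * a * t⁻¹ ∈ A := fun a ha => hAn t htG a ha
  have htA' : ∀ a ∈ A, t⁻¹ * a * t ∈ A := fun a ha => by
    simpa using hAn t⁻¹ (G₁.inv_mem htG) a ha
  have hzC : ∀ j : ℤ, t ^ j ∈ A → α (t ^ j) = j • φ t := fun j hj => by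
    rw [hC _ hj (B.zpow_mem ht j), addOn_map_zpow hφ ht]
  refine ⟨?_, ?_, ?_⟩
  · intro g hg h hh
    set x := g * t ^ (-(n g)) with hx
    set y := h * t ^ (-(n h)) with hy
    have hxA : x ∈ A := hn g hg
    have hyA : y ∈ A := hn h hh
    set j : ℤ := n g + n h - n (g * h) with hj
    have hconj : t ^ (n g) * y * (t ^ (n g))⁻¹ ∈ A := conj_zpow_mem htA htA' (n g) y hyA
    have e : g * h * t ^ (-(n (g * h))) = x * (t ^ (n g) * y * (t ^ (n g))⁻¹) * t ^ j := by
      rw [hx, hy, hj]; group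
    have htj : t ^ j ∈ A := by
      have : t ^ j = (x * (t ^ (n g) * y * (t ^ (n g))⁻¹))⁻¹ * (g * h * t ^ (-(n (g * h)))) := by
        rw [e]; group
      rw [this]
      exact A.mul_mem (A.inv_mem (A.mul_mem hxA hconj)) (hn (g * h) (G₁.mul_mem hg hh))
    rw [e, hα _ (A.mul_mem hxA hconj) _ htj, hα _ hxA _ hconj, conj_zpow_invariant htA htA' hinv (n g) y hyA,
      hzC j htj, hj]
    simp only [sub_smul, add_smul]
    abel
  · intro a ha
    have h1 : t ^ (-(n a)) ∈ A := by rw [zpow_neg]; exact A.inv_mem (hnA a ha)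
    rw [hα _ ha _ h1, hzC _ h1, neg_smul]
    abel
  · intro b hb _
    have h1 : b * t ^ (-(n b)) ∈ B := B.mul_mem hb (B.zpow_mem ht _)
    have hbG : b * t ^ (-(n b)) ∈ A := by
      -- not needed for the value, but `hC` wants membership in `A`: use `hn`? we only know `b ∈ G₁` via the hypothesis
      exact hn b ‹b ∈ G₁›
    rw [hC _ hbG h1, hφ _ hb _ (B.zpow_mem ht _), addOn_map_zpow hφ ht, neg_smul]
    abel

/-- **Extension along a complement.**  `N, D ≤ G` with `D` normalising `N` and `G = D·N` pointwise (`dec g = (d, n)`); `w₁` additive on `N`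
and invariant under conjugation by `D`; `α` additive on `D`; `α = w₁` on `D ∩ N`.  Then `w(g) := α(dec g).1 + w₁(dec g).2` is additive on `G`
and restricts to `w₁` on `N`, to `α` on `D` — independently of the chosen decomposition. [folklore] -/
theorem glueExtend {N D : Subgroup G} (hDn : ∀ d ∈ D, ∀ x ∈ N, d * x * d⁻¹ ∈ N) {w₁ α : G → Z}
    (hw₁ : ∀ x ∈ N, ∀ y ∈ N, w₁ (x * y) = w₁ x + w₁ y) (hinv : ∀ d ∈ D, ∀ x ∈ N, w₁ (d * x * d⁻¹) = w₁ x)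
    (hα : ∀ x ∈ D, ∀ y ∈ D, α (x * y) = α x + α y) (hC : ∀ x ∈ D, x ∈ N → α x = w₁ x)
    (dec : G → G × G) (hdec : ∀ g, (dec g).1 ∈ D ∧ (dec g).2 ∈ N ∧ g = (dec g).1 * (dec g).2) :
    (∀ g h, (α (dec (g * h)).1 + w₁ (dec (g * h)).2) = (α (dec g).1 + w₁ (dec g).2) + (α (dec h).1 + w₁ (dec h).2)) ∧
      (∀ d ∈ D, ∀ x ∈ N, α (dec (d * x)).1 + w₁ (dec (d * x)).2 = α d + w₁ x) := by
  -- independence of the decomposition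
  have key : ∀ d ∈ D, ∀ x ∈ N, ∀ d' ∈ D, ∀ x' ∈ N, d * x = d' * x' → α d + w₁ x = α d' + w₁ x' := by
    intro d hd x hx d' hd' x' hx' he
    -- `d'⁻¹ d = x' x⁻¹ ∈ D ∩ N`
    have e1 : d'⁻¹ * d = x' * x⁻¹ := by
      rw [eq_mul_inv_iff_mul_eq, mul_assoc, he]; group
    have hmD : d'⁻¹ * d ∈ D := D.mul_mem (D.inv_mem hd') hd
    have hmN : d'⁻¹ * d ∈ N := by rw [e1]; exact N.mul_mem hx' (N.inv_mem hx)
    have h1 : α (d'⁻¹ * d) = w₁ (x' * x⁻¹) := by rw [hC _ hmD hmN, e1]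
    rw [hα _ (D.inv_mem hd') _ hd, addOn_map_inv hα hd', hw₁ _ hx' _ (N.inv_mem hx), addOn_map_inv hw₁ hx] at h1
    -- `-α d' + α d = w₁ x' + -w₁ x`
    have h2 : α d - α d' = w₁ x' - w₁ x := by rw [sub_eq_neg_add, sub_eq_add_neg]; exact h1
    calc α d + w₁ x = (α d - α d') + (α d' + w₁ x) := by abel
      _ = (w₁ x' - w₁ x) + (α d' + w₁ x) := by rw [h2]
      _ = α d' + w₁ x' := by abel
  have hval : ∀ d ∈ D, ∀ x ∈ N, α (dec (d * x)).1 + w₁ (dec (d * x)).2 = α d + w₁ x := by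
    intro d hd x hx
    obtain ⟨h1, h2, h3⟩ := hdec (d * x)
    exact key _ h1 _ h2 _ hd _ hx h3.symm
  refine ⟨?_, hval⟩
  intro g h
  obtain ⟨hg1, hg2, hg3⟩ := hdec g
  obtain ⟨hh1, hh2, hh3⟩ := hdec h
  set d := (dec g).1; set x := (dec g).2; set d' := (dec h).1; set x' := (dec h).2
  -- `g h = (d d') · ((d'⁻¹ x d') x')`
  have hconj : d'⁻¹ * x * d' ∈ N := by simpa using hDn d'⁻¹ (D.inv_mem hh1) x hg2
  have e : g * h = (d * d') * ((d'⁻¹ * x * d') * x') := by rw [hg3, hh3]; group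
  rw [e, hval _ (D.mul_mem hg1 hh1) _ (N.mul_mem hconj hh2), hα _ hg1 _ hh1, hw₁ _ hconj _ hh2]
  have : w₁ (d'⁻¹ * x * d') = w₁ x := by
    have := hinv d'⁻¹ (D.inv_mem hh1) x hg2
    simpa using this
  rw [this]
  abel

end PShiftGlue

end Summit.BirchSwinnertonDyer.BirchSwinnertonDyer.Theorems.ManinLocalTwoThree
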